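import Summits.AtomisticToContinuum.Crystallization.Theorems.ChartedZeroExcessLayeredLatticeLiouvilleTO

/-!
# Zero-excess layered lattice Liouville — part TP (lens-2 g39): node «EnergyNearCharts» — the STABILITY LEAF (U♮) LOCALISED TO ENERGY-NEAR
CHARTS, the new energy piece (N♮) that delivers energy-nearness of the registered chart, the three stability consumers re-typed, the glue
(HC) ⟸ ten pieces RE-PROVED, and the columns `_16XH17` / `_16XH17W` / `_16XH17A0` (22 leaves; NO chart-wide stability leaf)

## The cut (critic VERDICT row 657 (4)(6), census TAG 199 «U♮ normal-strain Bloch scan» ordered; this node is delivered BEFORE TAG 199 posts and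
is the repair the critic named IF it bites — «(U♮ˣ) restricted to energy-near charts … with the seam re-proved» — and a strict weakening of the
stability leaf either way)
The column of record `_16XH16` (part TO) carries ONE chart-wide stability leaf, (U♮) `UniformTameStability (1/50) 2`: uniform tame coercivity of the
layered kernel of EVERY equilibrium `1/50`-chart `(L, w)` — `IsEquilChart a s Λ L w` pins only the operator bounds, the IN-PLANE conformality of `L`
and clean + single-site-Nash of `LayeredHom L w`; the layer GAPS are free up to cleanliness (normal strain ≈ ±6 %), and single-site Nash of a
homogeneous layered state fixes the registries and makes the TRANSMITTED NORMAL STRESS `P` constant through the stack, but does not make it zero.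
So (U♮) quantifies over uniaxially (normally) stressed Barlow stacks up to the clean edge — phonon-soft candidates (TAG 199).  Part TN's erratum (Σ)
showed the P-door producers MUST be allowed to output such strained charts; the only thing that excludes them downstream is ENERGY, and energy is
available exactly where the consumers live: the glue site of (HC) is the PG door, where `hasQuadExcess_of_isDoorSetPG` (BindingSurface) gives
`excess(win D) ≤ C₁·D²`.  THE NODE: thread an explicit per-site ENERGY-NEARNESS of the chart, `IsEnergyNear ν H := ∀ x ∈ H, e_x(H) ≤ e⋆ + ν`, through
the stability leaf and its three consumers, and add ONE new piece producing it from registration + quadratic excess: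
* (U♮ᴱ) `UniformTameStabilityE s Λ ν` := (U♮) with the extra chart hypothesis `IsEnergyNear ν (LayeredHom L w)`.  WEAKER ((U♮) ⇒ (U♮ᴱ)(ν) for every
  `ν`, `uniformTameStabilityE_of_tame`, PROVED; antitone in `ν`).  At `ν = 1/2000` an energy-near clean Nash chart has normal strain `≲ 1.5 %` and
  in-plane strain `≲ 0.7 %` (LJ: 5 % normal strain ≈ 6·10⁻³/site, 2 % in-plane ≈ 3–6·10⁻³/site), i.e. it lies in a neighbourhood of the RELAXED
  Barlow stacks whose size the census can set — the regime of TAG 174 (a⁗) (equilibrium slice, λ_rel ≥ 0.15) plus a perturbation margin, instead of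
  the whole clean window.  UNDECIDED · TRUE-type-expected · CERT (TAG 174 (a⁗) + TAG 199 restricted to |ε_n| ≤ 1.5 %) · INSTRUMENTABLE.
* (N♮) `EnergyNearChartPX aHi Λ θ s ν` — REGISTERED CHARTS OF QUADRATIC-EXCESS SETS ARE ENERGY-NEAR (door `IsDoorSetP` + the explicit energy input
  `HasQuadExcess C₁ S` of part TN, GSC-free by type, discharged at the glue site by BindingSurface): for every `δ, a, C₁, Cg` there are `η₁, R₁` with
  «`(L, w)` an equilibrium `s`-chart globally registering `S` at `(Cg, η, R)`, `η ≤ η₁`, `R ≥ R₁` ⇒ `IsEnergyNear ν (LayeredHom L w)`».  Mechanism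
  (three lemmas): (n1) NASH RIGIDITY of homogeneous layered states — single-site Nash ⇒ hollow registries and constant transmitted normal stress `P`,
  and in the clean window the gaps are the unique solution `g = G(P; word)` of the stress equations (nearest-layer term dominant, `r⁻⁷` tails a
  contraction): the equilibrium charts over a given word and in-plane metric form a ONE-parameter family; (n2) MATCHING — registration at level
  `Cg·η` on `win R` (two-sided `EnvClose`, clause (i) of `IsRegistered`) puts the chart's in-plane metric and its gaps within `C√(Cg η)` of the
  window's mean local geometry of `S` in mean square, and since `P` and the metric are UNIFORM through the chart the mismatch is paid at EVERY site,
  so it is caught by the mean-square level (no sparse escape); (n3) ENERGY — `HasQuadExcess` gives window-mean site energy of `S` `≤ e⋆ + C₁/R`,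
  Lipschitz dependence of the window energy on the misfit (incl. the summed `r⁻⁶` tail, as in (Z_E)'s mechanism) transfers it to the chart, and the
  homogeneous energy gap `e(P, e_in; word) − e_relaxed(word) ≥ c·(P² + e_in²)` (in-plane: census TAG 179 (z1ℓ); normal: interlayer stiffness, TAG
  «FORCE» λ = 1.72) forces `P² + e_in² ≤ C(C₁/R + √(Cg η))`; finally per site `e_x ≤ e⋆ + ε_w(local word) + C(P² + e_in²) ≤ e⋆ + ν` once
  `η ≤ η₁(ν, Cg)`, `R ≥ R₁(ν, C₁)` — PROVIDED `ν` exceeds the RELAXED-WORD FLOOR `ε_w := sup_words max_x (e_x(relaxed word) − e⋆)` (LJ lattice sums: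
  `e_fcc − e_hcp ≈ 8·10⁻⁵`, all Hägg words in between; `ν = 1/2000` has a factor ≈ 6).  UNDECIDED · TRUE-type (for `ν > ε_w`) · RIGIDITY + ENERGY ·
  ATTACKABLE·M · INSTRUMENTABLE (census: ε_w over words of period ≤ 6; CHAIN-MARGIN = invertibility of the linearised stress map `g ↦ P` on the clean
  window).  Why it might fail: a SECOND clean gap branch of `ψ′(g) = P` (beyond the inflection of the interlayer potential, ≈ +10 % — outside the
  clean window by the two-shell bound, to be confirmed) would break (n1)'s uniqueness and let sparse far layers strain at no mean-square cost; and
  `ν ≤ ε_w` makes it false outright (fcc slabs of bounded thickness are affordable under `HasQuadExcess`).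
* (A⁰ᴱ) `L2HarmonicApproxPE`, (D⁰ᴱ) `PositionDecayPLE`, (C♭ᴱ) `PositionCaccioppoliPGE` := (A⁰), (D⁰), (C♭) of part TC VERBATIM with the antecedent
  certificate `UniformTameStability s Λ` replaced by `UniformTameStabilityE s Λ ν` and the extra chart hypothesis `IsEnergyNear ν (LayeredHom L w)`.
  RE-TYPED (localised certificate: the same proof obligations, applied only to energy-near charts — each mechanism of part TC invokes stability
  only for the chart at hand); given (U♮) the old pieces imply the new ones (`…E_of_…`, PROVED), so nothing of `_16XH16` is lost.
* every other leaf VERBATIM: (T), (A0ˣ)(s,s′) and its sub-line (B1), (G♯ˣ), (Λ♭ˣ), (Υc), (Υb), (A0♯⁺), (FF), (E), (R_W) — (R_W) re-registers `Ψ`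
  but keeps the chart `(L, w)`, so energy-nearness, a property of the chart alone, survives the THIN/FAT split.
GLUE (PROVED, `harmonicContractionPGLms_of_ten_pieces_XE`): part TO's nine-piece glue with (N♮)'s ceiling/floor `(η_N, R_N)` taken at `(C₁, Cg)` right
after (A0ˣ) fixes `Cg`, joined to the `min`/`max`, and `IsEnergyNear ν (LayeredHom L w)` obtained from the (A0ˣ)-registration `Ψ` and handed to
(A⁰ᴱ), (D⁰ᴱ), (C♭ᴱ); everything else verbatim.  COLUMNS `_16XH17` (ν := 1/2000), `_16XH17W` ((A1) for (R_W)), `_16XH17A0` (the (A0)(1/50) spine), and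
the ν-generic `_16XH17_tol` with the monotonicity seams (`UniformTameStabilityE.anti`, `EnergyNearChartPX.mono`): the column holds for EVERY `ν` in the
window `ε_w < ν < ε_stab` and the literal only names a point of it (typing-checklist (iv): the threshold is a potential constant of `tameRadius` type,
not a hand-picked strength).
STATUS OF TAG 199 at typing time: not yet posted (census-1 g20 on TAG 198).  If TAG 199 finds λ_min ≤ 0 at some admissible normal strain, (U♮)
`UniformTameStability (1/50) 2` is a kill-candidate AS TYPED and `_16XH17` is the column of the (A0)-line; if it does not bite, `_16XH17` is still the
column with the weaker stability leaf (certifiable from the equilibrium slice by continuity) at the price of one TRUE-type energy leaf (N♮).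
## Why this is novel (relative to parts S, TC, TD, TN, TO)
Parts S/TC typed stability CHART-WIDE because the registration currency cannot see normal strain (TN's root cause (b)); TN/TO moved energy into the
PRODUCER side (`HasQuadExcess` ⇒ conformal output frame) but left the gaps free, so the consumers still needed (U♮) on strained stacks.  This node
moves the same energy input to the CONSUMER side through a new chart currency (`IsEnergyNear`), using the one structural fact that makes a per-site
energy bound equivalent to a strain bound for charts: Nash rigidity of homogeneous layered states (constant transmitted stress).  Structural
dichotomy reading: SPECIAL = energy-near (near-relaxed) charts, where stability is the census's equilibrium slice; GENERIC = stressed clean charts,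
which registration of a quadratic-excess set at small level / large scale CANNOT produce (N♮) — so they never reach the consumers.
## (c) of row 657: are (Z_E)(1/100) and (P)(1/100) tolerance-polymorphic IN TRUTH, and immune to a (Σ)-type witness at 1.2 % strain? (one paragraph)
YES for both, by inspection of the binders.  (Z_E) `ExcessChartLocalisationP aHi Λ θ s` chooses its own scale `a` (:= the relaxed nearest-neighbour
distance) and ceilings `(η_z, ε_z, R_z)` AFTER `δ`; its conclusion re-presents the SAME point set by an `s`-conformal `L′`, i.e. it only asserts that the
in-plane metric of a chart fitting an excess-`≤ εR³`, misfit-`≤ η` window is within `s` of `a·O(2)`: by the homogeneous energy gap this needs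
`C(ε_z + √η_z) ≤ c·s²`, so `s = 1/100` costs only smaller `(ε_z, η_z) ∝ s²`; the relaxed in-plane constants of different words differ by ≈ 10⁻⁵ ≪ s.
A window of `S` homogeneously strained IN-PLANE by `e = 1.2 %` has excess `≈ c·e²·R³ ≈ 2·10⁻³·R³ > ε_z·R³`, so it is outside (Z_E)'s hypothesis; strained
NORMALLY it leaves the read planes unstrained and the fitting chart is exactly conformal (`L′ := L`).  (P) `RegistrationP aHi Λ θ s` has input AND output
at tolerance `s` but its output LEVEL scales with the input level (`C·η`): an in-plane-strained `S` (strain `s + e′`) is `η`-fittable by an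
`s`-conformal chart only for `η ≳ 16e′²`, and then the equilibrium `s`-conformal chart at the boundary of the cone registers it at level `≤ C·16e′²`
(`C = O(1)`, Poisson mismatch of the gaps included); a NORMALLY strained clean Nash `S` is registered at level `C·η` by ITS OWN strained homogeneous
state, which IS an equilibrium `s`-chart (in-plane metric unstrained ⇒ conformal; clean; Nash) — (P) is true there precisely because `IsEquilChart`
leaves the gaps free, which is what makes (U♮) chart-wide and what this node localises.  So neither producer is bitten at `s = 1/100`; their
constants `η₁(s), R₁(s), ε_z(s)` shrink like `s²`, nothing else changes.
0 EQUIV; placeholder-free; no type-class declarations, custom syntax or option pragmas.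
-/

noncomputable section

open scoped BigOperators InnerProductSpace RealInnerProductSpace
open MeasureTheory Set Metric Filter Topology
open Summit.AtomisticToContinuum.Crystallization.Theorems.ChartedPlanarOrderRigidityDoor
  (E3 IsClean IsNash IsCharted IsEStarGSC VisibleGap PertRegime atomsIn siteEnergy eStar BindingSurface)
open Summit.AtomisticToContinuum.Crystallization.Theorems.ChartedPlanarOrderDensityDichotomy (μS IsSep nK nK_nonneg excess)
open Summit.AtomisticToContinuum.Crystallization.Theorems.ChartedPlanarOrderMesoCut (IsDoorSet NearHom LayeredHom EnvClose)
open Summit.AtomisticToContinuum.Crystallization.Theorems.OverbindingBudgetLiouvilleDictionary (NearHomBD)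
open Summit.AtomisticToContinuum.Crystallization.Theorems.ChartedPlanarOrderDoorLayered
  (TwoPeriodic DoorPeriodic PeriodicBulkGapDoor gap_and_pert_1_50_of_periodic NearHomL2BD nearHomL2BD_mono nearHomBD_of_nearHomL2BD
   sq_le_finsum_mem not_nearHomL2BD_singleton envClose_mono Layered layeredHom_eq_layered atomsIn_subset)
open Summit.AtomisticToContinuum.Crystallization.Theorems.ChartedPlanarOrderDoorLayeredOsc (IsTwoShellAffineGood DoorPeriodicOsc)
open Summit.AtomisticToContinuum.Crystallization.Theorems.ChartedPlanarOrderCleanScaleP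
  (IsCleanP IsDoorSetP DoorPeriodicP isDoorSetP_mono doorPeriodic_of_doorPeriodicP isDoorSetP_one_iff doorPeriodicP_one_iff)
open Summit.AtomisticToContinuum.Crystallization.Theorems.ChartedPlanarOrderProfileSlavingLJ (pairForce)
open Literature.MathematicalPhysics.StatisticalMechanics (haggLabel barlowOffset layerNormal IsHaggSeq triangularVec₁ triangularVec₂)


namespace Summit.AtomisticToContinuum.Crystallization.Theorems.ChartedZeroExcessLayeredLatticeLiouville

/-! ## §XVII  (lens-2 g39) node «EnergyNearCharts»

### XVII.1  The chart currency `IsEnergyNear` -/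

/-- **`IsEnergyNear ν H`** — every site of the point set `H` has site energy (w.r.t. `H`'s own counting measure, tree `siteEnergy` = half the
Lennard-Jones lattice sum, a Bochner integral against `μS H`: for separated `H` the absolutely convergent sum; were it not integrable the junk value `0`
would make the bound FAIL since `e⋆ + ν < 0` for the `ν` of interest, so the currency is never vacuously satisfied) at most `e⋆ + ν`.  For a clean
single-site-Nash homogeneous layered state this is — by Nash rigidity (constant transmitted normal stress, hollow registries) and the homogeneous
energy gap — a bound `≲ √ν` on its normal AND in-plane strain away from the relaxed stack of its word, up to the relaxed-word floor `ε_w ≈ 10⁻⁴`.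
[this file, g39] -/
def IsEnergyNear (ν : ℝ) (H : Set E3) : Prop :=
  ∀ x ∈ H, siteEnergy (μS H) x ≤ eStar + ν

/-- energy-nearness is monotone in the tolerance. [this file, g39] -/
theorem IsEnergyNear.mono {ν ν' : ℝ} (hν : ν ≤ ν') {H : Set E3} (h : IsEnergyNear ν H) : IsEnergyNear ν' H :=
  fun x hx => (h x hx).trans (by linarith)

/-! ### XVII.2  (U♮ᴱ) the stability leaf localised to energy-near charts -/

/-- ★★ **(U♮ᴱ) «UniformTameStabilityE s Λ ν»** — (U♮) `UniformTameStability s Λ` (part S) RESTRICTED TO `ν`-ENERGY-NEAR CHARTS: for every scale `a`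
uniform `(κ₀, c₀, C₁)` such that every equilibrium `s`-chart `(L, w)` about `a` WHOSE HOMOGENEOUS STATE IS `ν`-ENERGY-NEAR admits a tame, co-Lipschitz,
`κ₀`-coercive re-indexing `w'` of the same layered set (the four clauses of (U♮) verbatim).  WEAKER ((U♮) ⇒ (U♮ᴱ)(ν), PROVED; antitone in `ν`).
At the column literal `ν = 1/2000` the admissible charts are the clean Nash Barlow stacks within ≈ 1.5 % normal / 0.7 % in-plane strain of the relaxed
stack of their word — the equilibrium slice of census TAG 174 (a⁗) (λ_rel ≥ 0.15) plus a perturbative margin, instead of the whole clean window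
(normal strain ≈ ±6 %, census TAG 199).  STABILITY-type · UNDECIDED · TRUE-type-expected · CERT · INSTRUMENTABLE.
Why it might fail: a relaxed or ≤ 1.5 %-strained clean Nash Barlow word with a soft phonon (TAG 199 restricted to |ε_n| ≤ 1.5 %; bond stiffness
`V″` moves ≈ 20 % per 1 % bond strain against a 15 % relative margin — the literal may have to drop to `ν ≈ 1/5000`, see `_16XH17_tol`), or loss of
uniformity of `κ₀` along aperiodic words (layer-chain operator).
Sources: [this tree: part S `UniformTameStability`, `CoerciveZ`, `IsTameIndexing`], [census TAG 174 (a⁗) A174.md, TAG 199 (ordered)], [EMing2006 §2],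
[Ayala–Choksi–Wirth arXiv:2506.22614 (finite fcc LJ stability)], [Theil2006]. [this file, g39] -/
def UniformTameStabilityE (s Λ ν : ℝ) : Prop :=
  ∀ a : ℝ, 0 < a → ∃ κ₀ : ℝ, 0 < κ₀ ∧ ∃ c₀ : ℝ, 0 < c₀ ∧ ∃ C₁ : ℝ, 0 < C₁ ∧
    ∀ (L : E3 ≃L[ℝ] E3) (w : ℤ → E3), IsEquilChart a s Λ L w → IsEnergyNear ν (LayeredHom (L : E3 →L[ℝ] E3) w) →
      ∃ w' : ℤ → E3,
        Layered ((L : E3 →L[ℝ] E3) (triangularVec₁ 1)) ((L : E3 →L[ℝ] E3) (triangularVec₂ 1)) w' = LayeredHom (L : E3 →L[ℝ] E3) w ∧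
        IsLayeredCrystal c₀ ((L : E3 →L[ℝ] E3) (triangularVec₁ 1)) ((L : E3 →L[ℝ] E3) (triangularVec₂ 1)) w' ∧
        IsTameIndexing C₁ ((L : E3 →L[ℝ] E3) (triangularVec₁ 1)) ((L : E3 →L[ℝ] E3) (triangularVec₂ 1)) w' ∧
        CoerciveZ (layeredKernel ((L : E3 →L[ℝ] E3) (triangularVec₁ 1)) ((L : E3 →L[ℝ] E3) (triangularVec₂ 1)) w') κ₀

/-- seam (nothing lost): (U♮) ⇒ (U♮ᴱ)(ν) for every `ν` — forget the energy hypothesis. [this file, g39] -/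
theorem uniformTameStabilityE_of_tame {s Λ ν : ℝ} (h : UniformTameStability s Λ) : UniformTameStabilityE s Λ ν := by
  intro a ha
  obtain ⟨κ₀, hκ₀, c₀, hc₀, C₁, hC₁, h'⟩ := h a ha
  exact ⟨κ₀, hκ₀, c₀, hc₀, C₁, hC₁, fun L w hE _ => h' L w hE⟩

/-- (U♮ᴱ) is ANTITONE in the energy tolerance (more charts qualify at a larger `ν`). [this file, g39] -/
theorem UniformTameStabilityE.anti {s Λ ν ν' : ℝ} (hν : ν ≤ ν') (h : UniformTameStabilityE s Λ ν') : UniformTameStabilityE s Λ ν := by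
  intro a ha
  obtain ⟨κ₀, hκ₀, c₀, hc₀, C₁, hC₁, h'⟩ := h a ha
  exact ⟨κ₀, hκ₀, c₀, hc₀, C₁, hC₁, fun L w hE hN => h' L w hE (hN.mono hν)⟩

/-! ### XVII.3  (N♮) registered charts of quadratic-excess sets are energy-near -/

/-- ★★ **(N♮) «EnergyNearChartPX aHi Λ θ s ν»** — THE ENERGY PIECE OF THE CONSUMER SIDE, GSC-FREE BY TYPE (door `IsDoorSetP` + part TN's explicit energy
input `HasQuadExcess C₁ S`, discharged at the PG glue site by `hasQuadExcess_of_isDoorSetPG`): for every `δ, a, C₁, Cg` there are a ceiling `η₁` and a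
floor `R₁` such that «`(L, w)` an equilibrium `s`-chart about `a` and `Ψ` a global registration of `S` to `LayeredHom L w` at `(Cg, η, R)`, `η ≤ η₁`,
`R ≥ R₁` ⇒ `IsEnergyNear ν (LayeredHom L w)`».  Mechanism: (n1) NASH RIGIDITY of clean homogeneous layered states — hollow registries, constant
transmitted normal stress `P`, gaps `= G(P; word)` unique in the clean window (nearest-layer term dominant, `r⁻⁷` tails a contraction): a one-parameter
family over (word, in-plane metric); (n2) MATCHING — registration at mean-square level `Cg·η` on `win R` puts the chart's metric and gaps within
`C√(Cg η)` of the window's mean local geometry of `S`, and uniformity of `(P, metric)` through the chart means the mismatch is paid at every site (no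
sparse escape); (n3) ENERGY — window-mean site energy of `S` `≤ e⋆ + C₁/R` (`HasQuadExcess`), Lipschitz transfer to the chart through the misfit
(summed `r⁻⁶` tail included), homogeneous energy gap `≥ c(P² + e_in²)` above the relaxed word ⇒ per site `e_x ≤ e⋆ + ε_w + C(C₁/R + √(Cg η)) ≤ e⋆ + ν`
for `η ≤ η₁(ν, Cg)`, `R ≥ R₁(ν, C₁)`, PROVIDED `ν > ε_w` := the relaxed-word floor (`≈ e_fcc − e_hcp ≈ 8·10⁻⁵` for LJ lattice sums).  Monotone in `ν`.
RIGIDITY + ENERGY-type · UNDECIDED · TRUE-type (for `ν > ε_w`; at the column literal `1/2000` the margin is ≈ 6) · ATTACKABLE·M · INSTRUMENTABLE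
(census: ε_w over Hägg words of period ≤ 6 with relaxed gaps; CHAIN-MARGIN = invertibility of the linearised gap-to-stress map on the clean window).
Why it might fail: a second clean branch of the interlayer stress equation `ψ′(g) = P` (beyond the inflection, ≈ +10 % gap — believed outside the
two-shell clean window, to be confirmed) would void (n1)'s uniqueness and allow sparse strained far layers at no mean-square cost; `ν ≤ ε_w` makes the
statement false (bounded fcc slabs are affordable under `HasQuadExcess`); the Lipschitz transfer (n3) needs the two-sided tear-free clauses of
`IsGlobalReg` to control the chart's tail sums near the window (coarse chain constant `< 4`, `R ≥ R₁`).
Sources: [this tree: `IsEquilChart` (Q), `IsGlobalReg` (TB), `HasQuadExcess`/`hasQuadExcess_of_isDoorSetPG` (TN), `excess_window_le_of_gsc` (N),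
(Z_E) `ExcessChartLocalisationP` mechanism (P)], [EMing2006 §2 (inner relaxation of multilattices)], [Theil2006 §4 (lattice sums)], [Schwerdtfeger et
al. 2006, Phys. Rev. B 73, 064112 (LJ fcc/hcp lattice sums, `e_hcp < e_fcc` by ≈ 10⁻⁴)], [census TAG 179 (z1ℓ), TAG «FORCE» (λ = 1.72), TAG 199]. [this file, g39] -/
def EnergyNearChartPX (aHi Λ θ s ν : ℝ) : Prop :=
  ∀ δ : ℝ, 0 < δ → ∀ a : ℝ, 0 < a → ∀ C₁ : ℝ, 0 ≤ C₁ → ∀ Cg : ℝ, 1 ≤ Cg → ∃ η₁ : ℝ, 0 < η₁ ∧ ∃ R₁ : ℝ, 0 < R₁ ∧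
    ∀ S : Set E3, IsDoorSetP aHi δ S → (∀ q ∈ S, IsTwoShellAffineGood θ S q) → HasQuadExcess C₁ S →
      ∀ η : ℝ, 0 < η → η ≤ η₁ → ∀ R : ℝ, R₁ ≤ R →
        ∀ (L : E3 ≃L[ℝ] E3) (w : ℤ → E3), IsEquilChart a s Λ L w →
          ∀ Ψ : E3 → E3, IsGlobalReg Cg η R S (LayeredHom (L : E3 →L[ℝ] E3) w) Ψ →
            IsEnergyNear ν (LayeredHom (L : E3 →L[ℝ] E3) w)

/-- (N♮) is MONOTONE in the energy tolerance. [this file, g39] -/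
theorem EnergyNearChartPX.mono {aHi Λ θ s ν ν' : ℝ} (hν : ν ≤ ν') (h : EnergyNearChartPX aHi Λ θ s ν) : EnergyNearChartPX aHi Λ θ s ν' := by
  intro δ hδ a ha C₁ hC₁ Cg hCg
  obtain ⟨η₁, hη₁, R₁, hR₁, h'⟩ := h δ hδ a ha C₁ hC₁ Cg hCg
  exact ⟨η₁, hη₁, R₁, hR₁, fun S hS hg hQ η hη hηle R hR L w hE Ψ hG => (h' S hS hg hQ η hη hηle R hR L w hE Ψ hG).mono hν⟩

/-- (N♮) is ANTITONE in the ceiling `aHi`. [this file, g39] -/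
theorem EnergyNearChartPX.anti {aHi aHi' Λ θ s ν : ℝ} (hle : aHi ≤ aHi') (h : EnergyNearChartPX aHi' Λ θ s ν) : EnergyNearChartPX aHi Λ θ s ν := by
  intro δ hδ a ha C₁ hC₁ Cg hCg
  obtain ⟨η₁, hη₁, R₁, hR₁, h'⟩ := h δ hδ a ha C₁ hC₁ Cg hCg
  exact ⟨η₁, hη₁, R₁, hR₁, fun S hS => h' S (isDoorSetP_mono hle hS)⟩

/-! ### XVII.4  The three stability consumers re-typed on energy-near charts: (A⁰ᴱ), (D⁰ᴱ), (C♭ᴱ) -/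

/-- ★ **(A⁰ᴱ) «L2HarmonicApproxPE aHi Λ θ s ν»** — (A⁰) `L2HarmonicApproxP` (part TC) VERBATIM with the antecedent certificate (U♮) replaced by (U♮ᴱ)(ν)
and the extra chart hypothesis `IsEnergyNear ν (LayeredHom L w)`: the L²-harmonic approximation lemma in quantitative/duality form for displacements
globally registered to an ENERGY-NEAR equilibrium chart.  RE-TYPED (localised certificate; given (U♮), (A⁰) ⇒ (A⁰ᴱ), PROVED) · LINEAR · TRUE-type ·
ATTACKABLE·M–L.  Mechanism, why it might fail and sources: as (A⁰) — the compactness–contradiction now runs over the compact family of ENERGY-NEAR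
equilibrium charts (a closed subfamily), coercivity of the limit operators from (U♮ᴱ) − (T). [this file, g39] -/
def L2HarmonicApproxPE (aHi Λ θ s ν : ℝ) : Prop :=
  TailDominationCert → UniformTameStabilityE s Λ ν →
    ∀ δ : ℝ, 0 < δ → ∀ a : ℝ, 0 < a → ∀ Cg : ℝ, 1 ≤ Cg → ∃ CA : ℝ, 1 ≤ CA ∧
      ∀ ε : ℝ, 0 < ε → ∃ εr : ℝ, 0 < εr ∧ ∃ ϱ₁ : ℝ, 1 ≤ ϱ₁ ∧ ∀ ϱ : ℝ, ϱ₁ ≤ ϱ → ∃ η₁ : ℝ, 0 < η₁ ∧ ∃ R₁ : ℝ, 0 < R₁ ∧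
        ∀ S : Set E3, IsDoorSetP aHi δ S → (∀ q ∈ S, IsTwoShellAffineGood θ S q) →
          ∀ η : ℝ, 0 < η → η ≤ η₁ → ∀ R : ℝ, R₁ ≤ R →
            ∀ (L : E3 ≃L[ℝ] E3) (w : ℤ → E3), IsEquilChart a s Λ L w → IsEnergyNear ν (LayeredHom (L : E3 →L[ℝ] E3) w) →
              ∀ Ψ : E3 → E3, IsGlobalReg Cg η R S (LayeredHom (L : E3 →L[ℝ] E3) w) Ψ →
                LinResidualSmall εr ϱ η R S (LayeredHom (L : E3 →L[ℝ] E3) w) Ψ →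
                  ∃ h : E3 → E3,
                    IsTruncHarmonic ϱ (LayeredHom (L : E3 →L[ℝ] E3) w) h (LayeredHom (L : E3 →L[ℝ] E3) w ∩ closedBall (Ψ 0) (R / 8)) ∧
                    HasGradProfile (CA * η) (LayeredHom (L : E3 →L[ℝ] E3) w) (LayeredHom (L : E3 →L[ℝ] E3) w ∩ closedBall (Ψ 0) (R / 2))
                      (atomsIn (μS S) 0 R) h ∧
                    ∀ r : ℝ, 0 < r → r ≤ R / 64 →
                      ∑ᶠ x ∈ atomsIn (μS S) 0 r, ‖(x - Ψ x) - h (Ψ x)‖ ^ 2 ≤ ε * η * R ^ 2 * nK (atomsIn (μS S) 0 R)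

/-- ★ **(D⁰ᴱ) «PositionDecayPLE aHi Λ θ s ν»** — (D⁰) `PositionDecayPL` (part TC) VERBATIM with (U♮) ↦ (U♮ᴱ)(ν) and the extra chart hypothesis
`IsEnergyNear ν (LayeredHom L w)`: position-level decay of truncated-harmonic model fields toward the affine-layered Taylor class on ENERGY-NEAR
equilibrium charts.  RE-TYPED (given (U♮), (D⁰) ⇒ (D⁰ᴱ), PROVED) · DECAY-type (linear) · TRUE-type-indicated · ATTACKABLE·M.  Mechanism, why it might
fail and sources: as (D⁰). [this file, g39] -/
def PositionDecayPLE (aHi Λ θ s ν : ℝ) : Prop :=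
  TailDominationCert → UniformTameStabilityE s Λ ν → LayeredLiouvilleCert →
    ∀ δ : ℝ, 0 < δ → ∀ a : ℝ, 0 < a → ∀ Cg : ℝ, 1 ≤ Cg → ∀ CA : ℝ, 1 ≤ CA → ∃ CD : ℝ, 1 ≤ CD ∧
      ∃ ϱ₁ : ℝ, 1 ≤ ϱ₁ ∧ ∀ ϱ : ℝ, ϱ₁ ≤ ϱ → ∀ t : ℝ, 0 < t → t ≤ 1 / 128 → ∃ η₁ : ℝ, 0 < η₁ ∧ ∃ R₁ : ℝ, 0 < R₁ ∧
        ∀ S : Set E3, IsDoorSetP aHi δ S → (∀ q ∈ S, IsTwoShellAffineGood θ S q) →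
          ∀ η : ℝ, 0 < η → η ≤ η₁ → ∀ R : ℝ, R₁ ≤ R →
            ∀ (L : E3 ≃L[ℝ] E3) (w : ℤ → E3), IsEquilChart a s Λ L w → IsEnergyNear ν (LayeredHom (L : E3 →L[ℝ] E3) w) →
              ∀ Ψ : E3 → E3, IsGlobalReg Cg η R S (LayeredHom (L : E3 →L[ℝ] E3) w) Ψ →
                ∀ h : E3 → E3,
                  IsTruncHarmonic ϱ (LayeredHom (L : E3 →L[ℝ] E3) w) h (LayeredHom (L : E3 →L[ℝ] E3) w ∩ closedBall (Ψ 0) (R / 8)) →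
                  HasGradProfile (CA * η) (LayeredHom (L : E3 →L[ℝ] E3) w) (LayeredHom (L : E3 →L[ℝ] E3) w ∩ closedBall (Ψ 0) (R / 2))
                    (atomsIn (μS S) 0 R) h →
                    ∃ T : E3 → E3, IsAffineLayered (L : E3 →L[ℝ] E3) w T ∧
                      ∑ᶠ x ∈ atomsIn (μS S) 0 (2 * t * R), ‖h (Ψ x) - T (Ψ x)‖ ^ 2 ≤
                        CD * t ^ 7 * R ^ 2 * η * nK (atomsIn (μS S) 0 R)

/-- ★★ **(C♭ᴱ) «PositionCaccioppoliPGE aHi Λ θ s ν»** — (C♭) `PositionCaccioppoliPG` (part TC) VERBATIM with (U♮) ↦ (U♮ᴱ)(ν) and the extra chart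
hypothesis `IsEnergyNear ν (LayeredHom L w)`: position-level Caccioppoli at the contracted radius, consuming the wild fraction explicitly, around an
ENERGY-NEAR equilibrium chart (door `IsDoorSetPG`).  RE-TYPED (given (U♮), (C♭) ⇒ (C♭ᴱ), PROVED) · CACCIOPPOLI-type · TRUE-type-expected · ATTACKABLE·M–L.
Mechanism, why it might fail and sources: as (C♭) — the core-slice Gårding it needs is (U♮ᴱ)'s, i.e. on the energy-near slice only (TAG 174 (a⁗)). [this file, g39] -/
def PositionCaccioppoliPGE (aHi Λ θ s ν : ℝ) : Prop :=
  TailDominationCert → UniformTameStabilityE s Λ ν →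
    ∀ δ : ℝ, 0 < δ → ∀ a : ℝ, 0 < a → ∀ Cg : ℝ, 1 ≤ Cg → ∃ Cb : ℝ, 1 ≤ Cb ∧
      ∀ t : ℝ, 0 < t → t ≤ 1 / 128 → ∃ η₁ : ℝ, 0 < η₁ ∧ ∃ R₁ : ℝ, 0 < R₁ ∧
        ∀ S : Set E3, IsDoorSetPG aHi δ S → (∀ q ∈ S, IsTwoShellAffineGood θ S q) →
          ∀ η : ℝ, 0 < η → η ≤ η₁ → ∀ R : ℝ, R₁ ≤ R →
            ∀ (L : E3 ≃L[ℝ] E3) (w : ℤ → E3), IsEquilChart a s Λ L w → IsEnergyNear ν (LayeredHom (L : E3 →L[ℝ] E3) w) →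
              ∀ Ψ : E3 → E3, IsGlobalReg Cg η R S (LayeredHom (L : E3 →L[ℝ] E3) w) Ψ →
                ∀ (h T : E3 → E3), IsAffineLayered (L : E3 →L[ℝ] E3) w T →
                  ∀ κ₁ κ₂ κw : ℝ, 0 ≤ κ₁ → 0 ≤ κ₂ → 0 ≤ κw →
                    ∑ᶠ x ∈ atomsIn (μS S) 0 (2 * t * R), ‖(x - Ψ x) - h (Ψ x)‖ ^ 2 ≤
                        κ₁ * (t * R) ^ 2 * (t ^ 3 * nK (atomsIn (μS S) 0 R)) →
                      ∑ᶠ x ∈ atomsIn (μS S) 0 (2 * t * R), ‖h (Ψ x) - T (Ψ x)‖ ^ 2 ≤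
                          κ₂ * (t * R) ^ 2 * (t ^ 3 * nK (atomsIn (μS S) 0 R)) →
                        wildMass tameRadius (atomsIn (μS S) 0 R) Ψ ≤ κw * (t ^ 3 * nK (atomsIn (μS S) 0 R)) →
                          NearHomL2BD Λ (Cb * (κ₁ + κ₂ + κw)) 4 S (atomsIn (μS S) 0 (t * R))

/-- seam (nothing lost): given (U♮), (A⁰) ⇒ (A⁰ᴱ)(ν). [this file, g39] -/
theorem l2HarmonicApproxPE_of_P {aHi Λ θ s ν : ℝ} (hU : UniformTameStability s Λ) (h : L2HarmonicApproxP aHi Λ θ s) :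
    L2HarmonicApproxPE aHi Λ θ s ν := by
  intro hT _ δ hδ a ha Cg hCg
  obtain ⟨CA, hCA, h'⟩ := h hT hU δ hδ a ha Cg hCg
  refine ⟨CA, hCA, fun ε hε => ?_⟩
  obtain ⟨εr, hεr, ϱ₁, hϱ₁, h''⟩ := h' ε hε
  refine ⟨εr, hεr, ϱ₁, hϱ₁, fun ϱ hϱ => ?_⟩
  obtain ⟨η₁, hη₁, R₁, hR₁, h'''⟩ := h'' ϱ hϱ
  exact ⟨η₁, hη₁, R₁, hR₁, fun S hS hg η hη hηle R hR L w hEq _ Ψ hG hres => h''' S hS hg η hη hηle R hR L w hEq Ψ hG hres⟩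

/-- seam (nothing lost): given (U♮), (D⁰) ⇒ (D⁰ᴱ)(ν). [this file, g39] -/
theorem positionDecayPLE_of_PL {aHi Λ θ s ν : ℝ} (hU : UniformTameStability s Λ) (h : PositionDecayPL aHi Λ θ s) :
    PositionDecayPLE aHi Λ θ s ν := by
  intro hT _ hL' δ hδ a ha Cg hCg CA hCA
  obtain ⟨CD, hCD, ϱ₁, hϱ₁, h'⟩ := h hT hU hL' δ hδ a ha Cg hCg CA hCA
  refine ⟨CD, hCD, ϱ₁, hϱ₁, fun ϱ hϱ t ht ht' => ?_⟩
  obtain ⟨η₁, hη₁, R₁, hR₁, h''⟩ := h' ϱ hϱ t ht ht'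
  exact ⟨η₁, hη₁, R₁, hR₁, fun S hS hg η hη hηle R hR L w hEq _ Ψ hG hh hharm hgrad =>
    h'' S hS hg η hη hηle R hR L w hEq Ψ hG hh hharm hgrad⟩

/-- seam (nothing lost): given (U♮), (C♭) ⇒ (C♭ᴱ)(ν). [this file, g39] -/
theorem positionCaccioppoliPGE_of_PG {aHi Λ θ s ν : ℝ} (hU : UniformTameStability s Λ) (h : PositionCaccioppoliPG aHi Λ θ s) :
    PositionCaccioppoliPGE aHi Λ θ s ν := by
  intro hT _ δ hδ a ha Cg hCg
  obtain ⟨Cb, hCb, h'⟩ := h hT hU δ hδ a ha Cg hCg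
  refine ⟨Cb, hCb, fun t ht ht' => ?_⟩
  obtain ⟨η₁, hη₁, R₁, hR₁, h''⟩ := h' t ht ht'
  exact ⟨η₁, hη₁, R₁, hR₁, fun S hS hg η hη hηle R hR L w hEq _ Ψ hG hh T hT' κ₁ κ₂ κw h₁ h₂ hw hc₁ hc₂ hcw =>
    h'' S hS hg η hη hηle R hR L w hEq Ψ hG hh T hT' κ₁ κ₂ κw h₁ h₂ hw hc₁ hc₂ hcw⟩

end Summit.AtomisticToContinuum.Crystallization.Theorems.ChartedZeroExcessLayeredLatticeLiouville

end
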